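import Literature.Analysis.OperatorTheory.LehmannGoerisch
import Literature.Analysis.OperatorTheory.ProjectionLowerBound
import HarnessLib

/-!
# Rayleigh–Ritz (Poincaré) upper count with comparison forms; the monotonicity principle in counting form

Topic `Literature/Analysis/OperatorTheory`; proofs-layer companion of `LehmannGoerisch.lean` (theorems only, no definitions).

Setting = that of `rayleigh_ritz_count`: a pencil of real bilinear forms `M(u,v) = λ N(u,v)` on a vector space `D`, exact
`M`-orthonormal eigenpairs `(λ_i, φ_i)_{i<m}` with `λ_i > 0` which exhaust the spectrum below `ρ` (`hcompl : M ≥ ρ N` on their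
`M`-orthogonal complement), `N ≥ 0`, and a threshold `β ≤ ρ`.  `rayleigh_ritz_count` is Poincaré's inequalities
`λ_i ≤ Λ_i` [cite: WeinsteinStenger1972, Ch. 2 §1 Thm 1] in COUNTING form: an `n`-dimensional trial family with
`M(u,u) < β N(u,u)` on its non-zero members forces `n ≤ #{i : λ_i < β}`.

This file adds the COMPARISON-FORM versions a validated computation needs when the Rayleigh quotient can only be evaluated
(or certified) for a DOMINATING pencil `(M', N')` — `M ≤ M'` and `N' ≤ N` as quadratic forms on the trial functions, e.g.
elementwise frozen coefficients, a Loewner majorant of the potential, or trial functions living on a subdomain `Ω' ⊆ Ω` with their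
own forms and transferred into `D` by zero extension `E : D' → D` (the domination `A ≤ A'`, `𝔇(A') ⊆ 𝔇(A)`,
`(Au,u) ≤ (A'u,u)` of [cite: WeinsteinStenger1972, Ch. 2 §5 (1)–(2)]):

* `rayleigh_ritz_count_of_transfer` — trial space `D'` with its own forms `M', N'` and a linear transfer `E : D' →ₗ D`, comparison
  required on the trial range only;
* `rayleigh_ritz_count_of_le` — the same-space case (S-RR-1 of certnum `ode/DESIGN-pde.md` §6: «Rayleigh–Ritz upper count with
  comparison forms `a ≤ a_up`, `b_lo ≤ b`», the upper-side twin of `liu_count_bound_of_le`);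
* `rayleigh_lt_of_eigenfamily` — the span of an `M'`-orthonormal exact eigenfamily with eigenvalues `< β` is a trial family with
  `M' < β N'` on its non-zero members (the subspace `𝔘'_i = sp{u'_1, …, u'_i}` in the proof of the monotonicity principle);
* `card_eig_lt_le_of_dominated` / `card_eig_lt_le_of_le` — the MONOTONICITY PRINCIPLE `λ_i ≤ λ'_i` for `A ≤ A'`
  [cite: WeinsteinStenger1972, Ch. 2 §5 Thm 1] in counting form: every exact eigenfamily of the dominating pencil gives
  `#{j : λ'_j < β} ≤ #{i : λ_i < β}`. This is the step «`λ_n^{(s)}` is increasing in `s`, by Poincaré's min-max principle» of the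
  eigenvalue HOMOTOPY method [cite: BreuerMckennaPlum2003, §3 (24)–(25)];
* `rayleigh_ritz_count_of_le_of_matrices` — the certified entry point: Gram matrices `A0 = (M'(v_i,v_j))`, `A1 = (N'(v_i,v_j))` of
  trial vectors in `D'`, a coefficient matrix `Z`, and `β ZᵀA1Z − ZᵀA0Z ≻ 0` (interval Cholesky of a `k × k` matrix, via
  `rr_hypothesis_of_matrices`) give `k ≤ #{i : λ_i < β}`.

Pure bilinear algebra over `ℝ`; no topology and no spectral theorem (the exact eigen-data are hypotheses, exactly as in the
`LehmannGoerisch` / `ProjectionLowerBound` kernel files). WHAT IS NOT TYPED: the min-max characterisation itself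
[cite: WeinsteinStenger1972, Ch. 2 §2 Thm 1] and the existence of the exact eigenpairs; non-strict variants (`≤ β`); the strict
monotonicity `λ_i < λ'_i` of [cite: WeinsteinStenger1972, Ch. 2 §5 (5)].
-/

namespace Literature.Analysis.OperatorTheory

open scoped BigOperators

variable {D D' : Type*} [AddCommGroup D] [Module ℝ D] [AddCommGroup D'] [Module ℝ D']

/-- **Rayleigh–Ritz upper count through a transfer map, with comparison forms.** Exact data as in `rayleigh_ritz_count`
for the pencil `(M, N)` on `D`. Trial functions live in a second space `D'` carrying forms `M', N'` and are moved into `D` by a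
linear map `E` (zero extension from a subdomain, an inclusion of a form domain, the identity); on the trial range
`M(E u, E u) ≤ M'(u, u)` and `N'(u, u) ≤ N(E u, E u)` (domination `A ≤ A'` with `𝔇(A') ⊆ 𝔇(A)`). If the `n`-parameter trial family
has `M'(u,u) < β N'(u,u)` on its non-zero members and `0 ≤ β`, then at least `n` of the exact eigenvalues below `ρ` are `< β`.
[cite: WeinsteinStenger1972, Ch. 2 §1 Thm 1 (Poincaré), §5 (1)–(4)] -/
theorem rayleigh_ritz_count_of_transfer
    (M N : LinearMap.BilinForm ℝ D) (hM_symm : ∀ x y, M x y = M y x) (hN_symm : ∀ x y, N x y = N y x)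
    (hN_nonneg : ∀ x, 0 ≤ N x x)
    {m : ℕ} (φ : Fin m → D) (lam : Fin m → ℝ) {ρ β : ℝ} (hβρ : β ≤ ρ)
    (hφ_on : ∀ i j, M (φ i) (φ j) = if i = j then 1 else 0)
    (hφ_eig : ∀ i ψ, M (φ i) ψ = lam i * N (φ i) ψ)
    (hlam_pos : ∀ i, 0 < lam i)
    (hcompl : ∀ ψ, (∀ i, M (φ i) ψ = 0) → ρ * N ψ ψ ≤ M ψ ψ)
    (M' N' : LinearMap.BilinForm ℝ D') (E : D' →ₗ[ℝ] D) (hβ : 0 ≤ β)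
    {n : ℕ} (U : (Fin n → ℝ) →ₗ[ℝ] D')
    (hM_le : ∀ y, M (E (U y)) (E (U y)) ≤ M' (U y) (U y))
    (hN_le : ∀ y, N' (U y) (U y) ≤ N (E (U y)) (E (U y)))
    (hU : ∀ y, y ≠ 0 → M' (U y) (U y) < β * N' (U y) (U y)) :
    n ≤ Fintype.card {i : Fin m // lam i < β} := by
  refine rayleigh_ritz_count M N hM_symm hN_symm hN_nonneg φ lam hβρ hφ_on hφ_eig hlam_pos hcompl (E ∘ₗ U) ?_
  intro y hy
  rw [LinearMap.comp_apply]
  exact (hM_le y).trans_lt ((hU y hy).trans_le (mul_le_mul_of_nonneg_left (hN_le y) hβ))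

/-- **Rayleigh–Ritz upper count with comparison forms** (same space; S-RR-1). Exact data as in `rayleigh_ritz_count` for `(M, N)`;
comparison forms `M', N'` with `M(u,u) ≤ M'(u,u)` and `N'(u,u) ≤ N(u,u)` on the trial range (frozen coefficients, a majorant of
the potential, …). If the `n`-parameter trial family has `M'(u,u) < β N'(u,u)` on its non-zero members (certified from the Gram
matrices of `M', N'` by `rr_hypothesis_of_matrices`) and `0 ≤ β`, then `n ≤ #{i : λ_i < β}`. The upper-side twin of
`liu_count_bound_of_le`. [cite: WeinsteinStenger1972, Ch. 2 §1 Thm 1 (Poincaré), §5 (1)–(4)] -/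
theorem rayleigh_ritz_count_of_le
    (M N : LinearMap.BilinForm ℝ D) (hM_symm : ∀ x y, M x y = M y x) (hN_symm : ∀ x y, N x y = N y x)
    (hN_nonneg : ∀ x, 0 ≤ N x x)
    {m : ℕ} (φ : Fin m → D) (lam : Fin m → ℝ) {ρ β : ℝ} (hβρ : β ≤ ρ)
    (hφ_on : ∀ i j, M (φ i) (φ j) = if i = j then 1 else 0)
    (hφ_eig : ∀ i ψ, M (φ i) ψ = lam i * N (φ i) ψ)
    (hlam_pos : ∀ i, 0 < lam i)
    (hcompl : ∀ ψ, (∀ i, M (φ i) ψ = 0) → ρ * N ψ ψ ≤ M ψ ψ)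
    (M' N' : LinearMap.BilinForm ℝ D) (hβ : 0 ≤ β)
    {n : ℕ} (U : (Fin n → ℝ) →ₗ[ℝ] D)
    (hM_le : ∀ y, M (U y) (U y) ≤ M' (U y) (U y))
    (hN_le : ∀ y, N' (U y) (U y) ≤ N (U y) (U y))
    (hU : ∀ y, y ≠ 0 → M' (U y) (U y) < β * N' (U y) (U y)) :
    n ≤ Fintype.card {i : Fin m // lam i < β} :=
  rayleigh_ritz_count_of_transfer M N hM_symm hN_symm hN_nonneg φ lam hβρ hφ_on hφ_eig hlam_pos hcompl
    M' N' LinearMap.id hβ U hM_le hN_le hU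

/-- **Eigen-spans are trial families.** If `ψ₁, …, ψ_n` is an `M'`-orthonormal family with `M'(ψ_k, ·) = μ_k N'(ψ_k, ·)` and
`0 < μ_k < β`, then every non-zero combination `u = Σ c_k ψ_k` has `M'(u,u) = Σ c_k² < β Σ c_k²/μ_k = β N'(u,u)` (the subspace
`𝔘'_n = sp{u'_1, …, u'_n}` of the proof of the monotonicity principle). No symmetry or sign hypotheses on `M', N'` are needed.
[cite: WeinsteinStenger1972, Ch. 2 §2 (5), §5 (4)] -/
theorem rayleigh_lt_of_eigenfamily (M' N' : LinearMap.BilinForm ℝ D') {n : ℕ} (ψ : Fin n → D') (μ : Fin n → ℝ) {β : ℝ}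
    (hψ_on : ∀ k l, M' (ψ k) (ψ l) = if k = l then 1 else 0)
    (hψ_eig : ∀ k x, M' (ψ k) x = μ k * N' (ψ k) x)
    (hμ_pos : ∀ k, 0 < μ k) (hμ_lt : ∀ k, μ k < β) (c : Fin n → ℝ) (hc : c ≠ 0) :
    M' (Fintype.linearCombination ℝ ψ c) (Fintype.linearCombination ℝ ψ c)
      < β * N' (Fintype.linearCombination ℝ ψ c) (Fintype.linearCombination ℝ ψ c) := by
  classical
  have hlin : Fintype.linearCombination ℝ ψ c = ∑ k, c k • ψ k := by
    simp [Fintype.linearCombination_apply]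
  have hN_on : ∀ k l, N' (ψ k) (ψ l) = if k = l then 1 / μ k else 0 := by
    intro k l
    have hne : μ k ≠ 0 := (hμ_pos k).ne'
    have h : N' (ψ k) (ψ l) = M' (ψ k) (ψ l) / μ k := by
      rw [eq_div_iff hne, hψ_eig k (ψ l)]; ring
    rw [h, hψ_on]; split_ifs <;> simp
  have hM : M' (∑ k, c k • ψ k) (∑ l, c l • ψ l) = ∑ k, c k ^ 2 := by
    rw [bilin_sum_sum_of_kronecker M' ψ (fun _ => (1 : ℝ)) (by simpa using hψ_on) c]; simp
  have hN : N' (∑ k, c k • ψ k) (∑ l, c l • ψ l) = ∑ k, c k ^ 2 / μ k := by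
    rw [bilin_sum_sum_of_kronecker N' ψ (fun k => 1 / μ k) (by simpa using hN_on) c]
    refine Finset.sum_congr rfl fun k _ => ?_
    field_simp
  rw [hlin, hM, hN, Finset.mul_sum]
  obtain ⟨k₀, hk₀⟩ : ∃ k, c k ≠ 0 := Function.ne_iff.mp hc
  apply Finset.sum_lt_sum
  · intro k _
    have hμ := hμ_pos k
    rw [mul_div_assoc', le_div_iff₀ hμ]
    nlinarith [sq_nonneg (c k), (hμ_lt k).le]
  · refine ⟨k₀, Finset.mem_univ _, ?_⟩
    have hμ := hμ_pos k₀
    rw [mul_div_assoc', lt_div_iff₀ hμ]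
    have hck : 0 < c k₀ ^ 2 := by positivity
    nlinarith [hμ_lt k₀]

/-- **Monotonicity principle, counting form** (Weinstein–Stenger; the eigenvalue-homotopy step of Breuer–McKenna–Plum).
Exact data as in `rayleigh_ritz_count` for the pencil `(M, N)` on `D` (eigenpairs `(λ_i, φ_i)_{i<m}` exhausting the spectrum
below `ρ`). Let `(M', N')` on `D'` DOMINATE `(M, N)` through a linear transfer `E : D' →ₗ D`: `M(E x, E x) ≤ M'(x, x)` and
`N'(x, x) ≤ N(E x, E x)` for all `x` (`A ≤ A'`, `𝔇(A') ⊆ 𝔇(A)`). Then for every `M'`-orthonormal exact eigenfamily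
`(λ'_j, φ'_j)_{j<m'}` of the dominating pencil with `λ'_j > 0` and every `β ≤ ρ`:
`#{j : λ'_j < β} ≤ #{i : λ_i < β}` — i.e. `λ_i ≤ λ'_i` below `ρ`, the printed `λ_i ≤ max_{u ∈ 𝔘'_i} R(u) ≤ max_{u ∈ 𝔘'_i} R'(u) = λ'_i`.
No symmetry or sign hypotheses on `M', N'`; no completeness of the primed family is needed (any sub-family may be used).
[cite: WeinsteinStenger1972, Ch. 2 §5 Thm 1 (3)–(4)] [cite: BreuerMckennaPlum2003, §3 (24)–(25)] -/
theorem card_eig_lt_le_of_dominated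
    (M N : LinearMap.BilinForm ℝ D) (hM_symm : ∀ x y, M x y = M y x) (hN_symm : ∀ x y, N x y = N y x)
    (hN_nonneg : ∀ x, 0 ≤ N x x)
    {m : ℕ} (φ : Fin m → D) (lam : Fin m → ℝ) {ρ β : ℝ} (hβρ : β ≤ ρ)
    (hφ_on : ∀ i j, M (φ i) (φ j) = if i = j then 1 else 0)
    (hφ_eig : ∀ i ψ, M (φ i) ψ = lam i * N (φ i) ψ)
    (hlam_pos : ∀ i, 0 < lam i)
    (hcompl : ∀ ψ, (∀ i, M (φ i) ψ = 0) → ρ * N ψ ψ ≤ M ψ ψ)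
    (M' N' : LinearMap.BilinForm ℝ D') (E : D' →ₗ[ℝ] D)
    (hM_le : ∀ x, M (E x) (E x) ≤ M' x x) (hN_le : ∀ x, N' x x ≤ N (E x) (E x))
    {m' : ℕ} (φ' : Fin m' → D') (lam' : Fin m' → ℝ)
    (hφ'_on : ∀ i j, M' (φ' i) (φ' j) = if i = j then 1 else 0)
    (hφ'_eig : ∀ i ψ, M' (φ' i) ψ = lam' i * N' (φ' i) ψ)
    (hlam'_pos : ∀ i, 0 < lam' i) :
    Fintype.card {j : Fin m' // lam' j < β} ≤ Fintype.card {i : Fin m // lam i < β} := by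
  classical
  -- the index set of the primed eigenvalues below `β`, enumerated by `Fin n'`
  obtain hn | hn := Nat.eq_zero_or_pos (Fintype.card {j : Fin m' // lam' j < β})
  · rw [hn]; exact Nat.zero_le _
  obtain ⟨j₀⟩ : Nonempty {j : Fin m' // lam' j < β} := Fintype.card_pos_iff.mp hn
  have hβ : 0 ≤ β := ((hlam'_pos j₀.1).trans j₀.2).le
  let e := Fintype.equivFin {j : Fin m' // lam' j < β}
  let ψ : Fin (Fintype.card {j : Fin m' // lam' j < β}) → D' := fun k => φ' (e.symm k).1
  let μ : Fin (Fintype.card {j : Fin m' // lam' j < β}) → ℝ := fun k => lam' (e.symm k).1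
  have hψ_on : ∀ k l, M' (ψ k) (ψ l) = if k = l then 1 else 0 := by
    intro k l
    simp only [ψ, hφ'_on, Subtype.val_inj, EmbeddingLike.apply_eq_iff_eq]
  have hψ_eig : ∀ k x, M' (ψ k) x = μ k * N' (ψ k) x := fun k x => hφ'_eig _ x
  have hμ_pos : ∀ k, 0 < μ k := fun k => hlam'_pos _
  have hμ_lt : ∀ k, μ k < β := fun k => (e.symm k).2
  exact rayleigh_ritz_count_of_transfer M N hM_symm hN_symm hN_nonneg φ lam hβρ hφ_on hφ_eig hlam_pos hcompl
    M' N' E hβ (Fintype.linearCombination ℝ ψ) (fun y => hM_le _) (fun y => hN_le _)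
    (rayleigh_lt_of_eigenfamily M' N' ψ μ hψ_on hψ_eig hμ_pos hμ_lt)

/-- **Monotonicity principle, counting form, same space** (`E = id`): if `M(x,x) ≤ M'(x,x)` and `N'(x,x) ≤ N(x,x)` for all `x`
(e.g. the potential/coefficient homotopy `(24)` of Breuer–McKenna–Plum at two parameter values `s ≤ s'`), every `M'`-orthonormal
exact eigenfamily of `(M', N')` gives `#{j : λ'_j < β} ≤ #{i : λ_i < β}` for the exact eigen-data of `(M, N)` below `ρ ≥ β`.
[cite: WeinsteinStenger1972, Ch. 2 §5 Thm 1 (3)] [cite: BreuerMckennaPlum2003, §3 (25)] -/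
theorem card_eig_lt_le_of_le
    (M N : LinearMap.BilinForm ℝ D) (hM_symm : ∀ x y, M x y = M y x) (hN_symm : ∀ x y, N x y = N y x)
    (hN_nonneg : ∀ x, 0 ≤ N x x)
    {m : ℕ} (φ : Fin m → D) (lam : Fin m → ℝ) {ρ β : ℝ} (hβρ : β ≤ ρ)
    (hφ_on : ∀ i j, M (φ i) (φ j) = if i = j then 1 else 0)
    (hφ_eig : ∀ i ψ, M (φ i) ψ = lam i * N (φ i) ψ)
    (hlam_pos : ∀ i, 0 < lam i)
    (hcompl : ∀ ψ, (∀ i, M (φ i) ψ = 0) → ρ * N ψ ψ ≤ M ψ ψ)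
    (M' N' : LinearMap.BilinForm ℝ D)
    (hM_le : ∀ x, M x x ≤ M' x x) (hN_le : ∀ x, N' x x ≤ N x x)
    {m' : ℕ} (φ' : Fin m' → D) (lam' : Fin m' → ℝ)
    (hφ'_on : ∀ i j, M' (φ' i) (φ' j) = if i = j then 1 else 0)
    (hφ'_eig : ∀ i ψ, M' (φ' i) ψ = lam' i * N' (φ' i) ψ)
    (hlam'_pos : ∀ i, 0 < lam' i) :
    Fintype.card {j : Fin m' // lam' j < β} ≤ Fintype.card {i : Fin m // lam i < β} :=
  card_eig_lt_le_of_dominated M N hM_symm hN_symm hN_nonneg φ lam hβρ hφ_on hφ_eig hlam_pos hcompl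
    M' N' LinearMap.id hM_le hN_le φ' lam' hφ'_on hφ'_eig hlam'_pos

section MatrixGlue
open Matrix

/-- **Certified entry point for the comparison count.** Exact data as in `rayleigh_ritz_count` for `(M, N)` on `D`; symmetric
comparison forms `M', N'` on a trial space `D'` dominating `(M, N)` through `E : D' →ₗ D` (`M(E x,E x) ≤ M'(x,x)`,
`N'(x,x) ≤ N(E x,E x)`); trial vectors `v_1..v_n ∈ D'` with Gram matrices `A0 = (M'(v_i,v_j))`, `A1 = (N'(v_i,v_j))` (interval
entries of the FROZEN / subdomain forms — the only ones the computation evaluates) and a coefficient matrix `Z` (float approximate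
Ritz vectors suffice). If `β ZᵀA1Z − ZᵀA0Z ≻ 0` (interval Cholesky of a `k × k` matrix) and `0 ≤ β ≤ ρ`, then `k ≤ #{i : λ_i < β}`.
[cite: WeinsteinStenger1972, Ch. 2 §3 (10), §5 Thm 1] -/
theorem rayleigh_ritz_count_of_le_of_matrices
    (M N : LinearMap.BilinForm ℝ D) (hM_symm : ∀ x y, M x y = M y x) (hN_symm : ∀ x y, N x y = N y x)
    (hN_nonneg : ∀ x, 0 ≤ N x x)
    {m : ℕ} (φ : Fin m → D) (lam : Fin m → ℝ) {ρ β : ℝ} (hβρ : β ≤ ρ)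
    (hφ_on : ∀ i j, M (φ i) (φ j) = if i = j then 1 else 0)
    (hφ_eig : ∀ i ψ, M (φ i) ψ = lam i * N (φ i) ψ)
    (hlam_pos : ∀ i, 0 < lam i)
    (hcompl : ∀ ψ, (∀ i, M (φ i) ψ = 0) → ρ * N ψ ψ ≤ M ψ ψ)
    (M' N' : LinearMap.BilinForm ℝ D') (hM'_symm : ∀ x y, M' x y = M' y x) (hN'_symm : ∀ x y, N' x y = N' y x)
    (E : D' →ₗ[ℝ] D) (hβ : 0 ≤ β)
    (hM_le : ∀ x, M (E x) (E x) ≤ M' x x) (hN_le : ∀ x, N' x x ≤ N (E x) (E x))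
    {n k : ℕ} (v : Fin n → D') (A0 A1 : Matrix (Fin n) (Fin n) ℝ)
    (hA0 : ∀ i j, A0 i j = M' (v i) (v j)) (hA1 : ∀ i j, A1 i j = N' (v i) (v j))
    (Z : Matrix (Fin n) (Fin k) ℝ)
    (hpos : (β • (Zᵀ * A1 * Z) - Zᵀ * A0 * Z).PosDef) :
    k ≤ Fintype.card {i : Fin m // lam i < β} := by
  classical
  let U : (Fin k → ℝ) →ₗ[ℝ] D' := Fintype.linearCombination ℝ v ∘ₗ Z.mulVecLin
  have hU : ∀ y, U y = ∑ j, (Z *ᵥ y) j • v j := by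
    intro y
    simp [U, Fintype.linearCombination_apply]
  have hlt := rr_hypothesis_of_matrices M' N' hM'_symm hN'_symm v A0 A1 hA0 hA1 Z β U hU hpos
  exact rayleigh_ritz_count_of_transfer M N hM_symm hN_symm hN_nonneg φ lam hβρ hφ_on hφ_eig hlam_pos hcompl
    M' N' E hβ U (fun y => hM_le _) (fun y => hN_le _) hlt

end MatrixGlue

end Literature.Analysis.OperatorTheory
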